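import Mathlib
import HarnessLib
import Literature.MathematicalPhysics.QuantumLattice.HubbardRingPerronFrobeniusProofs
import Literature.MathematicalPhysics.QuantumLattice.HubbardGrandCanonicalDensity
import Summits.HubbardSuperconductivity.HubbardSuperconductivity.Theorems.WeakCouplingBCSWcbcsBcsConstructionDoubleCommutatorBound
import Summits.HubbardSuperconductivity.HubbardSuperconductivity.Theorems.WeakCouplingBCSWcbcsBcsConstructionTrialStateBound
import Summits.HubbardSuperconductivity.HubbardSuperconductivity.Theorems.WeakCouplingBCSWcbcsLegendreCeilingTrialState
import Summits.HubbardSuperconductivity.HubbardSuperconductivity.Theorems.WeakCouplingBCSWcbcsLegendreCeilingCooperLog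
import Summits.HubbardSuperconductivity.HubbardSuperconductivity.Theorems.WeakCouplingBCSWcbcsSourcedFreeGasCooperLogBdG
import Summits.HubbardSuperconductivity.HubbardSuperconductivity.Theorems.WeakCouplingBCSWcbcsSourcedFreeGasCooperLogFermiSea
import Summits.HubbardSuperconductivity.HubbardSuperconductivity.Theorems.WeakCouplingBCSWcbcsTowerTrialBudgetSlater

/-!
# Route `WeakCouplingBCS` — support item `WcbcsLegendreCeiling` (stmt-HubbardSuperconductivity-1197)

**The Legendre ceiling on the pair order of the weakly repulsive 2D Hubbard ground states.** For every
pair form factor `g` (on-site and nearest-neighbour singlet pairs, `pairField g L = Δ_g`) and every hole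
doping `δ ∈ (0, 1)` there are `C`, `U₀ ∈ (0, 1)` such that for `0 < U < U₀` and all large `L` EVERY
normalised ground state `ψ` of `hubbardTorus 2 L 1 U` in the sector `(N_L, S^z = 0)`,
`N_L = 2⌊(1-δ)L²/2⌋`, obeys `L⁻⁴ ⟨ψ, Δ_g† Δ_g ψ⟩ ≤ C U log(1/U)` (`wcbcsLegendreCeiling_proof`, whose
TYPE is the body of `Summit.HubbardSuperconductivity.HubbardSuperconductivity.Theses.WeakCouplingBCS.WcbcsLegendreCeiling`
spelled out; the Theses module is deliberately not imported, see the route header).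

Proof (finite `L`, no expansion): the Koma–Tasaki trial vector `Ξ = ψ + Oψ/‖Oψ‖`, `O = Δ_g + Δ_g†`
(`WcbcsLegendre.sector_trial_bound`) tested against the FREE gas with pair source
`K_μ - hO`, `μ = μ_L` the canonical shell level of `N_L` free electrons, gives
`h‖Oψ‖ ≤ E_U - μN_L + |μ| + ‖[O,[O,H_U]]‖/(4‖Oψ‖²) - E₀(K_μ - hO)`; the sector energy is at most
the free one plus `U N_L²/(4L²) ≤ U L²` (`WcbcsSlater.minEnergyOn_szSector_hubbardTorus_two_le`), the free
sector energy matches the grand-canonical one at the shell level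
(`free_sectorEnergy_sub_fermiLevel_mul_le`), the sourced free energy is at least
`Σ_k (ξ_k - √(ξ_k² + h²w_g(k)²))` (`sum_bdgLevel_le_groundEnergy_sourcedFreeTorus`), the difference is
the Cooper logarithm `≤ C₁ h² log(1/h) L²`
(`exists_sum_bdgGain_le`, the shell level staying in `(-4, 0)` by `exists_fermiLevel_window`), and the
double commutator is `O(L²)` by graded locality (`dc_norm_doubleCommutator_pairField_le`). With
`h² = U/log(1/U)` the budget `h‖Oψ‖ ≤ (C₁+1)UL² + 4 + K L²/‖Oψ‖²` forces
`‖Oψ‖² ≤ ((C₁+3)² + 1) U log(1/U) L⁴` for `L ≥ L₀(U)` (`endgame`), and `⟨Δ_g†Δ_g⟩ ≤ ‖Oψ‖²`.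
Koma–Tasaki, J. Stat. Phys. 76 (1994) 745, Thm 2.2. No definitions; everything is proved.
-/

set_option linter.dupNamespace false

namespace Summit.HubbardSuperconductivity.HubbardSuperconductivity.Theorems

namespace WcbcsLegendre

open Literature.MathematicalPhysics.QuantumLattice Literature.Probability.LatticeModels Matrix Finset
open WcbcsTrialState
open scoped Matrix.Norms.L2Operator ComplexOrder ComplexConjugate

/-- `⟨ψ, Xᴴ X ψ⟩ ≤ ‖(X + Xᴴ)ψ‖²` for a charged `X` (`[Nn, X] = -2X`) and an `Nn`-eigenvector `ψ`:
`Xψ ⊥ Xᴴψ`. [folklore] -/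
theorem re_conjTranspose_mul_le_charged {m : Type*} [Fintype m] {Nn X : Matrix m m ℂ}
    (hNn : Nn.IsHermitian) (hX : Nn * X - X * Nn = ((-2 : ℝ) : ℂ) • X) {ψ : m → ℂ} {a : ℝ}
    (hNψ : Nn *ᵥ ψ = (a : ℂ) • ψ) :
    (star ψ ⬝ᵥ ((Xᴴ * X) *ᵥ ψ)).re ≤ (star ((X + Xᴴ) *ᵥ ψ) ⬝ᵥ ((X + Xᴴ) *ᵥ ψ)).re := by
  have hX' := commutator_conjTranspose_of_commutator hNn hX
  have hm := eigen_mulVec_of_commutator hX hNψ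
  have hp := eigen_mulVec_of_commutator hX' hNψ
  have h34 := star_dotProduct_eq_zero_of_eigen hNn hm hp (by linarith)
  have h43 := star_dotProduct_eq_zero_of_eigen hNn hp hm (by linarith)
  have hsplit : (X + Xᴴ) *ᵥ ψ = X *ᵥ ψ + Xᴴ *ᵥ ψ := add_mulVec _ _ _
  have e1 : star (X *ᵥ ψ) ⬝ᵥ (X *ᵥ ψ) = star ψ ⬝ᵥ ((Xᴴ * X) *ᵥ ψ) :=
    Literature.MathematicalPhysics.QuantumLattice.star_mulVec_dotProduct_mulVec X X ψ
  rw [hsplit, star_add, add_dotProduct, dotProduct_add, dotProduct_add, h34, h43, add_zero, zero_add,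
    Complex.add_re, e1]
  have := (Complex.nonneg_iff.1 (dotProduct_star_self_nonneg (Xᴴ *ᵥ ψ))).1
  linarith

/-- **The end-game arithmetic.** If `h² = U/ℓ` with `ℓ ≥ 1`, `U > 0`, `4 ≤ U L²`, `K ≤ U² L⁴`, `q > 0`
and `h √q ≤ (C₁+1) U L² + 4 + K L²/q`, then `q ≤ ((C₁+3)² + 1) U ℓ L⁴` (otherwise `q > U L⁴`, the last
two terms are `≤ U L²` each, and squaring contradicts). [folklore] -/
theorem endgame {h q U ℓ Lr C₁ K : ℝ} (hU : 0 < U) (hℓ : 1 ≤ ℓ) (hh : 0 < h) (hh2 : h ^ 2 = U / ℓ)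
    (hLr : 0 < Lr) (h4 : 4 ≤ U * Lr ^ 2) (hK : K ≤ U ^ 2 * Lr ^ 4) (hK0 : 0 ≤ K)
    (hq : 0 < q) (hmain : h * Real.sqrt q ≤ (C₁ + 1) * U * Lr ^ 2 + 4 + K * Lr ^ 2 / q) :
    q ≤ ((C₁ + 3) ^ 2 + 1) * U * ℓ * Lr ^ 4 := by
  by_contra hcon
  push Not at hcon
  have hℓ0 : 0 < ℓ := by linarith
  have hL4 : 0 < Lr ^ 4 := by positivity
  have hUL : U * Lr ^ 4 ≤ q := by
    have h1 : U * Lr ^ 4 ≤ ((C₁ + 3) ^ 2 + 1) * U * ℓ * Lr ^ 4 := by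
      have h2 : (1 : ℝ) ≤ ((C₁ + 3) ^ 2 + 1) * ℓ := by nlinarith [sq_nonneg (C₁ + 3)]
      have h3 : 0 ≤ U * Lr ^ 4 := by positivity
      nlinarith
    linarith
  have hKq : K * Lr ^ 2 / q ≤ U * Lr ^ 2 := by
    rw [div_le_iff₀ hq]
    have h1 : K * Lr ^ 2 ≤ U ^ 2 * Lr ^ 4 * Lr ^ 2 := mul_le_mul_of_nonneg_right hK (by positivity)
    have h2 : U ^ 2 * Lr ^ 4 * Lr ^ 2 = U * Lr ^ 2 * (U * Lr ^ 4) := by ring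
    have h3 : U * Lr ^ 2 * (U * Lr ^ 4) ≤ U * Lr ^ 2 * q := mul_le_mul_of_nonneg_left hUL (by positivity)
    linarith
  have hB : h * Real.sqrt q ≤ (C₁ + 3) * U * Lr ^ 2 := by
    have : (C₁ + 1) * U * Lr ^ 2 + 4 + K * Lr ^ 2 / q ≤ (C₁ + 3) * U * Lr ^ 2 := by nlinarith
    linarith
  have hB0 : 0 ≤ h * Real.sqrt q := by positivity
  have hsq : (h * Real.sqrt q) ^ 2 ≤ ((C₁ + 3) * U * Lr ^ 2) ^ 2 := pow_le_pow_left₀ hB0 hB 2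
  rw [mul_pow, Real.sq_sqrt hq.le, hh2] at hsq
  -- `(U/ℓ) q ≤ (C₁+3)² U² L⁴` gives `q ≤ (C₁+3)² U ℓ L⁴ < ((C₁+3)²+1) U ℓ L⁴ < q`
  have h1 : q ≤ (C₁ + 3) ^ 2 * U * ℓ * Lr ^ 4 := by
    have h2 : U / ℓ * q * ℓ ≤ ((C₁ + 3) * U * Lr ^ 2) ^ 2 * ℓ := mul_le_mul_of_nonneg_right hsq hℓ0.le
    have h3 : U / ℓ * q * ℓ = U * q := by field_simp
    rw [h3] at h2
    have h4 : U * q ≤ U * ((C₁ + 3) ^ 2 * U * ℓ * Lr ^ 4) := by nlinarith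
    exact le_of_mul_le_mul_left h4 hU
  have h2 : (C₁ + 3) ^ 2 * U * ℓ * Lr ^ 4 < ((C₁ + 3) ^ 2 + 1) * U * ℓ * Lr ^ 4 := by
    have : 0 < U * ℓ * Lr ^ 4 := by positivity
    nlinarith
  linarith

/-- `log(1/h) h² ≤ U` for `h² = U/ℓ`, `ℓ = log(1/U) ≥ 1`: `log(1/h) = (ℓ + log ℓ)/2 ≤ ℓ`. [folklore] -/
theorem hsq_log_le {U ℓ h : ℝ} (hU : 0 < U) (hℓ : ℓ = Real.log (1 / U)) (hℓ1 : 1 ≤ ℓ)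
    (hh2 : h ^ 2 = U / ℓ) : h ^ 2 * Real.log (1 / h) ≤ U := by
  have hℓ0 : 0 < ℓ := by linarith
  have hlog : Real.log (1 / h) = (ℓ + Real.log ℓ) / 2 := by
    have h1 : Real.log (1 / h) = -(Real.log (h ^ 2)) / 2 := by
      rw [Real.log_pow, one_div, Real.log_inv]; push_cast; ring
    rw [h1, hh2, Real.log_div hU.ne' hℓ0.ne', hℓ, one_div, Real.log_inv]
    ring
  have hlogℓ : Real.log ℓ ≤ ℓ := (Real.log_le_sub_one_of_pos hℓ0).trans (by linarith)
  rw [hlog, hh2]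
  have : U / ℓ * ((ℓ + Real.log ℓ) / 2) ≤ U / ℓ * ℓ :=
    mul_le_mul_of_nonneg_left (by linarith) (by positivity)
  calc U / ℓ * ((ℓ + Real.log ℓ) / 2) ≤ U / ℓ * ℓ := this
    _ = U := by field_simp

/-- The momentum profile of the pair field is bounded: `|w_g(k)| ≤ √2 Σ_e |g e|`. [folklore] -/
theorem abs_pairFieldMode_le (g : Site 2 → ℝ) (L : ℕ) [NeZero L] (k : TorusSite 2 L) :
    |pairFieldMode g L k| ≤ Real.sqrt 2 * ∑ e ∈ insert (0 : Site 2) unitSteps, |g e| := by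
  rw [pairFieldMode, abs_mul, abs_of_nonneg (Real.sqrt_nonneg 2)]
  refine mul_le_mul_of_nonneg_left ((Finset.abs_sum_le_sum_abs _ _).trans
    (Finset.sum_le_sum fun e _ => ?_)) (Real.sqrt_nonneg 2)
  rw [abs_mul]
  have h1 : |(torusChar k (Torus.proj L e)).re| ≤ 1 := by
    have := Complex.abs_re_le_norm (torusChar k (Torus.proj L e))
    rwa [norm_torusChar] at this
  calc |g e| * |(torusChar k (Torus.proj L e)).re| ≤ |g e| * 1 :=
        mul_le_mul_of_nonneg_left h1 (abs_nonneg _)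
    _ = |g e| := mul_one _

section Torus

variable {L : ℕ} [NeZero L]

omit [NeZero L] in
/-- `H(1,U) = H(1,0) + U Σ_x n_{x↑}n_{x↓}` on the torus. [folklore] -/
theorem hubbardTorus_eq_add_interaction (U : ℝ) :
    hubbardTorus 2 L 1 U = hubbardTorus 2 L 1 0 +
      (U : ℂ) • ∑ x : FermionTorus 2 L, numberOp x 0 * numberOp x 1 := by
  have h := hamiltonianWith_sub_hamiltonianWith (fermionTorusGraph 2 L) 1 0 U 0
  simp only [hamiltonianWith_zero, sub_zero] at h
  exact sub_eq_iff_eq_add'.1 h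

omit [NeZero L] in
/-- The comparison Hamiltonian: `H(1,U) - UΣn↑n↓ - μN - hO = (H(1,0) - μN) - hO`. [folklore] -/
theorem comparison_eq (U μ h : ℝ) (O : Matrix (Finset (Orb (FermionTorus 2 L))) (Finset (Orb (FermionTorus 2 L))) ℂ) :
    hubbardTorus 2 L 1 U - (U : ℂ) • (∑ x : FermionTorus 2 L, numberOp x 0 * numberOp x 1) -
        (μ : ℂ) • totalNumber - (h : ℂ) • O =
      hubbardTorusWith 2 L 1 0 μ - (h : ℂ) • O := by
  rw [hubbardTorus_eq_add_interaction U, hubbardTorusWith_eq, add_sub_cancel_right]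

/-- **The finite-`L` budget.** For `L ≥ 3`, `0 ≤ U ≤ 2`, a normalised ground state `ψ` of `H(1,U)` in
the sector `(2n, S^z = 0)` with `0 < 2n ≤ 2L²` and `q = ‖(Δ_g + Δ_g†)ψ‖² > 0`, every source `h`, a bound
`‖[O,[O,H(1,U)]]‖ ≤ B(2 + U)L²` on the double commutator and a bound `G` on the BdG gain sum
`Σ_k (√(ξ_k² + h²w_g(k)²) - |ξ_k|)`, `ξ_k = ε_L(k) - μ_L`, `μ_L = torusFermiLevel L (2n)`:
`h √q ≤ U L² + |μ_L| + B L²/q + G`. [cite: KomaTasaki1994, Theorem 2.2] -/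
theorem finiteL_budget (hL : 3 ≤ L) (g : Site 2 → ℝ) {U : ℝ} (hU : 0 ≤ U) (hU2 : U ≤ 2) (h : ℝ) {n : ℕ}
    (hn0 : 0 < 2 * n) (hnL : 2 * n ≤ 2 * L ^ 2) {ψ : Fock (Orb (FermionTorus 2 L))}
    (hψ : IsGroundStateInSector (hubbardTorus 2 L 1 U) (2 * n) 0 ψ) (hψ1 : star ψ ⬝ᵥ ψ = 1)
    (hq : 0 < (star ((pairField g L + (pairField g L)ᴴ) *ᵥ ψ) ⬝ᵥ ((pairField g L + (pairField g L)ᴴ) *ᵥ ψ)).re)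
    {B G : ℝ}
    (hDC : ‖(pairField g L + (pairField g L)ᴴ) *
          ((pairField g L + (pairField g L)ᴴ) * hubbardTorus 2 L 1 U -
            hubbardTorus 2 L 1 U * (pairField g L + (pairField g L)ᴴ)) -
        ((pairField g L + (pairField g L)ᴴ) * hubbardTorus 2 L 1 U -
            hubbardTorus 2 L 1 U * (pairField g L + (pairField g L)ᴴ)) *
          (pairField g L + (pairField g L)ᴴ)‖ ≤ B * (2 * 1 + U) * (L : ℝ) ^ 2)
    (hG : ∑ k : TorusSite 2 L, (Real.sqrt ((torusBand L k - torusFermiLevel L (2 * n)) ^ 2 +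
          (h * pairFieldMode g L k) ^ 2) - |torusBand L k - torusFermiLevel L (2 * n)|) ≤ G) :
    h * Real.sqrt (star ((pairField g L + (pairField g L)ᴴ) *ᵥ ψ) ⬝ᵥ ((pairField g L + (pairField g L)ᴴ) *ᵥ ψ)).re ≤
      U * (L : ℝ) ^ 2 + |torusFermiLevel L (2 * n)| +
        B * (L : ℝ) ^ 2 / (star ((pairField g L + (pairField g L)ᴴ) *ᵥ ψ) ⬝ᵥ ((pairField g L + (pairField g L)ᴴ) *ᵥ ψ)).re +
        G := by
  set μ := torusFermiLevel L (2 * n) with hμ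
  obtain ⟨hmem, -, hHψ⟩ := hψ
  have hNψ : IsNParticle (2 * n) ψ := ((mem_szSector_iff _ _ _).1 hmem).1
  have hNψ' := WcbcsTrialState.totalNumber_mulVec_of_isNParticle hNψ
  have hNh : (totalNumber : Matrix (Finset (Orb (FermionTorus 2 L))) _ ℂ).IsHermitian := totalNumber_isHermitian
  have hX : totalNumber * pairField g L - pairField g L * totalNumber = ((-2 : ℝ) : ℂ) • pairField g L := by
    have h1 := totalNumber_commutator_pairFieldAt g L 0
    rw [pairFieldAt_zero] at h1
    rw [h1, Complex.ofReal_neg, Complex.ofReal_ofNat]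
  have hNH : totalNumber * hubbardTorus 2 L 1 U - hubbardTorus 2 L 1 U * totalNumber =
      ((0 : ℝ) : ℂ) • hubbardTorus 2 L 1 U := by
    have h1 := totalNumber_commutator_hubbardTorusWith L U 0
    rwa [hubbardTorusWith_zero] at h1
  have hH : (hubbardTorus 2 L 1 U).IsHermitian := by
    have h1 := isHermitian_hubbardTorusWith L 1 U 0
    rwa [hubbardTorusWith_zero] at h1
  have hP : (∑ x : FermionTorus 2 L, numberOp x 0 * numberOp x 1 :
      Matrix (Finset (Orb (FermionTorus 2 L))) _ ℂ).PosSemidef := posSemidef_sum_numberOp_mul_numberOp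
  have key := sector_trial_bound (μ := μ) (h := h) hH hNh hP hX hNH hψ1 hNψ' hHψ hU hq
  rw [comparison_eq U μ h] at key
  -- the sector energy from above and the sourced free energy from below
  have hn : 0 < n := by omega
  have hnL' : n ≤ L ^ 2 := by omega
  have hne : ψ ≠ 0 := by
    intro h0
    rw [h0, mulVec_zero, dotProduct_zero, Complex.zero_re] at hq
    exact lt_irrefl _ hq
  have hE1 := WcbcsSlater.minEnergyOn_szSector_hubbardTorus_two_le L 1 hU hmem hne
  have hE2 := free_sectorEnergy_sub_fermiLevel_mul_le hL hn hnL'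
  rw [← hμ] at hE2
  have hLpos : (0 : ℝ) < L := by exact_mod_cast Nat.pos_of_ne_zero (NeZero.ne L)
  have hL2 : (0 : ℝ) < (L : ℝ) ^ 2 := by positivity
  have hUN : U * ((2 * n : ℕ) : ℝ) ^ 2 / (4 * (L : ℝ) ^ 2) ≤ U * (L : ℝ) ^ 2 := by
    rw [div_le_iff₀ (by positivity)]
    have h1 : ((2 * n : ℕ) : ℝ) ≤ 2 * (L : ℝ) ^ 2 := by exact_mod_cast hnL
    have h2 : ((2 * n : ℕ) : ℝ) ^ 2 ≤ (2 * (L : ℝ) ^ 2) ^ 2 := pow_le_pow_left₀ (by positivity) h1 2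
    have h3 : U * ((2 * n : ℕ) : ℝ) ^ 2 ≤ U * (2 * (L : ℝ) ^ 2) ^ 2 := mul_le_mul_of_nonneg_left h2 hU
    have h4 : U * (2 * (L : ℝ) ^ 2) ^ 2 = U * (L : ℝ) ^ 2 * (4 * (L : ℝ) ^ 2) := by ring
    linarith
  have hE0 := sum_bdgLevel_le_groundEnergy_sourcedFreeTorus hL g μ h
  have hmode : ∀ k : TorusSite 2 L, (torusBand L k - μ) -
      Real.sqrt ((torusBand L k - μ) ^ 2 + (h * pairFieldMode g L k) ^ 2) =
      2 * min (torusBand L k - μ) 0 - (Real.sqrt ((torusBand L k - μ) ^ 2 + (h * pairFieldMode g L k) ^ 2) -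
        |torusBand L k - μ|) := by
    intro k
    have := neg_add_abs_eq (torusBand L k - μ)
    linarith
  rw [Finset.sum_congr rfl fun k _ => hmode k, Finset.sum_sub_distrib, ← Finset.mul_sum] at hE0
  -- the double commutator term
  have hB0 : 0 ≤ B := by
    have h1 : 0 ≤ B * (2 * 1 + U) * (L : ℝ) ^ 2 := (norm_nonneg _).trans hDC
    have h2 : 0 < (2 * 1 + U) * (L : ℝ) ^ 2 := by positivity
    by_contra hB
    push Not at hB
    have : B * (2 * 1 + U) * (L : ℝ) ^ 2 < 0 := by nlinarith
    linarith
  -- abstract the heavy terms before the linear arithmetic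
  set q := (star ((pairField g L + (pairField g L)ᴴ) *ᵥ ψ) ⬝ᵥ ((pairField g L + (pairField g L)ᴴ) *ᵥ ψ)).re
    with hqdef
  set DC := ‖(pairField g L + (pairField g L)ᴴ) *
          ((pairField g L + (pairField g L)ᴴ) * hubbardTorus 2 L 1 U -
            hubbardTorus 2 L 1 U * (pairField g L + (pairField g L)ᴴ)) -
        ((pairField g L + (pairField g L)ᴴ) * hubbardTorus 2 L 1 U -
            hubbardTorus 2 L 1 U * (pairField g L + (pairField g L)ᴴ)) *
          (pairField g L + (pairField g L)ᴴ)‖ with hDCdef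
  have hDCq : DC / (4 * q) ≤ B * (L : ℝ) ^ 2 / q := by
    rw [div_le_div_iff₀ (by positivity) hq]
    have h1 : DC * q ≤ B * (2 * 1 + U) * (L : ℝ) ^ 2 * q := mul_le_mul_of_nonneg_right hDC hq.le
    have h2 : B * (2 * 1 + U) * (L : ℝ) ^ 2 * q ≤ B * (L : ℝ) ^ 2 * (4 * q) := by
      have h3 : 0 ≤ B * (L : ℝ) ^ 2 * q := by positivity
      have h4 : B * (2 * 1 + U) * (L : ℝ) ^ 2 * q = (2 + U) * (B * (L : ℝ) ^ 2 * q) := by ring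
      have h5 : B * (L : ℝ) ^ 2 * (4 * q) = 4 * (B * (L : ℝ) ^ 2 * q) := by ring
      rw [h4, h5]
      exact mul_le_mul_of_nonneg_right (by linarith) h3
    exact h1.trans h2
  clear_value q DC
  set E := (hubbardTorus 2 L 1 U).minEnergyOn (szSector (2 * n) 0) with hEdef
  set E0 := (hubbardTorus 2 L 1 0).minEnergyOn (szSector (2 * n) 0) with hE0def
  set EK := (hubbardTorusWith 2 L 1 0 μ - (h : ℂ) • (pairField g L + (pairField g L)ᴴ)).groundEnergy with hEKdef
  set Smin := ∑ k : TorusSite 2 L, min (torusBand L k - μ) 0 with hSmin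
  set Sg := ∑ k : TorusSite 2 L, (Real.sqrt ((torusBand L k - μ) ^ 2 + (h * pairFieldMode g L k) ^ 2) -
    |torusBand L k - μ|) with hSg
  clear_value E E0 EK Smin Sg
  have hcast : (((2 * n : ℕ) : ℝ)) = 2 * (n : ℝ) := by push_cast; ring
  rw [hcast] at key hE2
  linarith [key, hE1, hE2, hE0, hUN, hDCq, hG]

end Torus

/-- **Legendre ceiling** (support item `WcbcsLegendreCeiling` of route `WeakCouplingBCS`, type = the
route declaration's body). For every form factor `g` and doping `δ ∈ (0,1)` there are `C`, `U₀ ∈ (0,1)`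
such that for `0 < U < U₀` and all large `L` every normalised `(N_L, S^z = 0)`-sector ground state `ψ`
of `hubbardTorus 2 L 1 U`, `N_L = 2⌊(1-δ)L²/2⌋`, has `L⁻⁴ Re⟨ψ, Δ_g†Δ_g ψ⟩ ≤ C U log(1/U)`.
[cite: KomaTasaki1994, Theorem 2.2] -/
theorem wcbcsLegendreCeiling_proof :
    ∀ (g : Literature.Probability.LatticeModels.Site 2 → ℝ) (δ : ℝ), δ ∈ Set.Ioo (0:ℝ) 1 → ∃ C U₀ : ℝ, 0 < U₀ ∧ U₀ < 1 ∧ ∀ U : ℝ, U ∈ Set.Ioo (0:ℝ) U₀ → ∃ L₀ : ℕ, ∀ L : ℕ, L₀ ≤ L → ∀ ψ : Literature.MathematicalPhysics.QuantumLattice.Fock (Literature.MathematicalPhysics.QuantumLattice.Orb (Literature.MathematicalPhysics.QuantumLattice.FermionTorus 2 (L + 1))), Literature.MathematicalPhysics.QuantumLattice.IsGroundStateInSector (Literature.MathematicalPhysics.QuantumLattice.hubbardTorus 2 (L + 1) 1 U) (2 * ⌊(1 - δ) * ((L + 1 : ℕ) : ℝ) ^ 2 / 2⌋₊) 0 ψ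 → star ψ ⬝ᵥ ψ = 1 → (Literature.MathematicalPhysics.QuantumLattice.expect (Matrix.conjTranspose (Literature.MathematicalPhysics.QuantumLattice.pairField g (L + 1)) * Literature.MathematicalPhysics.QuantumLattice.pairField g (L + 1)) ψ).re / ((L + 1 : ℕ) : ℝ) ^ 4 ≤ C * U * Real.log (1 / U) := by
  intro g δ hδ
  obtain ⟨hδ0, hδ1⟩ := hδ
  -- constants
  set A : ℝ := Real.sqrt 2 * ∑ e ∈ insert (0 : Site 2) unitSteps, |g e| with hA
  have hA0 : 0 ≤ A := by positivity
  obtain ⟨d₀, hd₀, L₁, hwin⟩ := exists_fermiLevel_window hδ0 hδ1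
  obtain ⟨C₁, hC₁, hcooper⟩ := exists_sum_bdgGain_le hd₀ hA0
  set K : ℝ := 144 * ((insert (0 : Site 2) unitSteps).card : ℝ) ^ 2 * ((insert (0 : Site 2) unitSteps).card + 2) *
    (2 * ∑ e ∈ insert (0 : Site 2) unitSteps, |g e / Real.sqrt 2|) ^ 2 with hK
  have hK0 : 0 ≤ K := by positivity
  refine ⟨(C₁ + 3) ^ 2 + 1, Real.exp (-2), Real.exp_pos _, by
    rw [← Real.exp_zero]; exact Real.exp_lt_exp.2 (by norm_num), ?_⟩
  intro U hU
  obtain ⟨hU0, hU1⟩ := hU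
  set ℓ : ℝ := Real.log (1 / U) with hℓ
  have hℓ2 : 2 < ℓ := by
    rw [hℓ, Real.lt_log_iff_exp_lt (by positivity), lt_div_iff₀ hU0]
    calc Real.exp 2 * U < Real.exp 2 * Real.exp (-2) := mul_lt_mul_of_pos_left hU1 (Real.exp_pos _)
      _ = 1 := by rw [← Real.exp_add]; norm_num
  have hℓ1 : 1 ≤ ℓ := by linarith
  have hℓ0 : 0 < ℓ := by linarith
  set h : ℝ := Real.sqrt (U / ℓ) with hh
  have hh0 : 0 < h := Real.sqrt_pos.2 (by positivity)
  have hh2 : h ^ 2 = U / ℓ := Real.sq_sqrt (by positivity)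
  have hU2 : U < Real.exp (-2) := hU1
  have hhe : h ≤ Real.exp (-1) := by
    have he2 : Real.exp (-1) ^ 2 = Real.exp (-2) := by rw [sq, ← Real.exp_add]; norm_num
    have h1 : h ^ 2 ≤ Real.exp (-1) ^ 2 := by
      rw [hh2, he2]
      have h2 : U / ℓ ≤ U := div_le_self hU0.le hℓ1
      linarith
    exact (pow_le_pow_iff_left₀ hh0.le (Real.exp_pos _).le two_ne_zero).1 h1
  have hUle2 : U ≤ 2 := by
    have := Real.exp_le_one_iff.2 (show (-2 : ℝ) ≤ 0 by norm_num)
    linarith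
  -- the threshold on `L`
  obtain ⟨L₀, hL₀⟩ : ∃ L₀ : ℕ, ∀ L : ℕ, L₀ ≤ L → 3 ≤ L + 1 ∧ L₁ ≤ L + 1 ∧ 1 / h ≤ ((L + 1 : ℕ) : ℝ) ∧
      4 / U ≤ ((L + 1 : ℕ) : ℝ) ∧ K / U ^ 2 ≤ ((L + 1 : ℕ) : ℝ) := by
    obtain ⟨m, hm⟩ := exists_nat_gt (max (max (1 / h) (4 / U)) (K / U ^ 2))
    refine ⟨max (max 3 L₁) m, fun L hL => ?_⟩
    have h1 : max (max 3 L₁) m ≤ L + 1 := hL.trans (Nat.le_succ L)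
    have hm' : (m : ℝ) ≤ ((L + 1 : ℕ) : ℝ) := by exact_mod_cast (le_max_right _ _).trans h1
    have hm1 : 1 / h < m := ((le_max_left _ _).trans (le_max_left _ _)).trans_lt hm
    have hm2 : 4 / U < m := ((le_max_right _ _).trans (le_max_left _ _)).trans_lt hm
    have hm3 : K / U ^ 2 < m := (le_max_right _ _).trans_lt hm
    exact ⟨(le_max_left _ _).trans ((le_max_left _ _).trans h1),
      (le_max_right _ _).trans ((le_max_left _ _).trans h1), by linarith, by linarith, by linarith⟩
  refine ⟨L₀, fun L hL ψ hψ hψ1 => ?_⟩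
  obtain ⟨h3, hL₁L, hLh, hL4, hLK⟩ := hL₀ L hL
  obtain ⟨hN0, hN2, hμ4, hμ0⟩ := hwin (L + 1) hL₁L
  have hLr0 : (0 : ℝ) < ((L + 1 : ℕ) : ℝ) := by positivity
  have hLr1 : (1 : ℝ) ≤ ((L + 1 : ℕ) : ℝ) := by exact_mod_cast Nat.succ_le_succ (Nat.zero_le L)
  set n : ℕ := ⌊(1 - δ) * ((L + 1 : ℕ) : ℝ) ^ 2 / 2⌋₊ with hn
  set μ : ℝ := torusFermiLevel (L + 1) (2 * n) with hμdef
  set X := pairField g (L + 1) with hXdef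
  set q : ℝ := (star ((X + Xᴴ) *ᵥ ψ) ⬝ᵥ ((X + Xᴴ) *ᵥ ψ)).re with hqdef
  -- `⟨Δ†Δ⟩ ≤ q`
  have hmemψ : ψ ∈ szSector (2 * n) 0 := hψ.1
  have hNψ : IsNParticle (2 * n) ψ := ((mem_szSector_iff _ _ _).1 hmemψ).1
  have hX : totalNumber * X - X * totalNumber = ((-2 : ℝ) : ℂ) • X := by
    have h1 := totalNumber_commutator_pairFieldAt g (L + 1) 0
    rw [pairFieldAt_zero] at h1
    rw [hXdef, h1, Complex.ofReal_neg, Complex.ofReal_ofNat]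
  have heq : (expect (Xᴴ * X) ψ).re ≤ q :=
    re_conjTranspose_mul_le_charged totalNumber_isHermitian hX (WcbcsTrialState.totalNumber_mulVec_of_isNParticle hNψ)
  have hgoal : q ≤ ((C₁ + 3) ^ 2 + 1) * U * ℓ * ((L + 1 : ℕ) : ℝ) ^ 4 := by
    by_contra hcon
    push Not at hcon
    have hq : 0 < q := lt_of_le_of_lt (by positivity) hcon
    -- the Cooper logarithm
    have hD : ∀ k : TorusSite 2 (L + 1), |h * pairFieldMode g (L + 1) k| ≤ A * h := by
      intro k
      rw [abs_mul, abs_of_pos hh0, mul_comm]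
      exact mul_le_mul_of_nonneg_right (abs_pairFieldMode_le g (L + 1) k) hh0.le
    have hG := hcooper μ hμ4 hμ0 h hh0 hhe (L + 1) hLh (fun k => h * pairFieldMode g (L + 1) k) hD
    beta_reduce at hG
    have hG' : C₁ * h ^ 2 * Real.log (1 / h) * ((L + 1 : ℕ) : ℝ) ^ 2 ≤ C₁ * U * ((L + 1 : ℕ) : ℝ) ^ 2 := by
      have h0 := hsq_log_le hU0 hℓ hℓ1 hh2
      have h1 : 0 ≤ C₁ * ((L + 1 : ℕ) : ℝ) ^ 2 := by positivity
      calc C₁ * h ^ 2 * Real.log (1 / h) * ((L + 1 : ℕ) : ℝ) ^ 2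
          = C₁ * ((L + 1 : ℕ) : ℝ) ^ 2 * (h ^ 2 * Real.log (1 / h)) := by ring
        _ ≤ C₁ * ((L + 1 : ℕ) : ℝ) ^ 2 * U := mul_le_mul_of_nonneg_left h0 h1
        _ = C₁ * U * ((L + 1 : ℕ) : ℝ) ^ 2 := by ring
    -- the double commutator
    have hDC := dc_norm_doubleCommutator_pairField_le g (L + 1) 1 U 0
    rw [hubbardTorusWith_zero, ← hK, abs_one, abs_zero, mul_zero, add_zero, abs_of_pos hU0] at hDC
    -- the finite-`L` budget
    have hbud := finiteL_budget h3 g hU0.le hUle2 h hN0 hN2 hψ hψ1 hq hDC hG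
    rw [← hXdef, ← hμdef, ← hqdef] at hbud
    have hμabs : |μ| ≤ 4 := by
      rw [abs_le]; constructor <;> linarith
    have h4U : 4 ≤ U * ((L + 1 : ℕ) : ℝ) ^ 2 := by
      have h1 : 4 ≤ U * ((L + 1 : ℕ) : ℝ) := by rw [div_le_iff₀ hU0] at hL4; linarith
      have h2 : U * ((L + 1 : ℕ) : ℝ) ≤ U * ((L + 1 : ℕ) : ℝ) ^ 2 := by
        refine mul_le_mul_of_nonneg_left ?_ hU0.le
        calc ((L + 1 : ℕ) : ℝ) = ((L + 1 : ℕ) : ℝ) ^ 1 := (pow_one _).symm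
          _ ≤ ((L + 1 : ℕ) : ℝ) ^ 2 := pow_le_pow_right₀ hLr1 (by norm_num)
      linarith
    have hKU : K ≤ U ^ 2 * ((L + 1 : ℕ) : ℝ) ^ 4 := by
      have h1 : K ≤ U ^ 2 * ((L + 1 : ℕ) : ℝ) := by
        rw [div_le_iff₀ (by positivity)] at hLK; linarith
      have h2 : U ^ 2 * ((L + 1 : ℕ) : ℝ) ≤ U ^ 2 * ((L + 1 : ℕ) : ℝ) ^ 4 := by
        refine mul_le_mul_of_nonneg_left ?_ (by positivity)
        calc ((L + 1 : ℕ) : ℝ) = ((L + 1 : ℕ) : ℝ) ^ 1 := (pow_one _).symm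
          _ ≤ ((L + 1 : ℕ) : ℝ) ^ 4 := pow_le_pow_right₀ hLr1 (by norm_num)
      linarith
    have hmain : h * Real.sqrt q ≤ (C₁ + 1) * U * ((L + 1 : ℕ) : ℝ) ^ 2 + 4 +
        K * ((L + 1 : ℕ) : ℝ) ^ 2 / q := by
      linarith [hbud, hG', hμabs]
    exact absurd (endgame hU0 hℓ1 hh0 hh2 hLr0 h4U hKU hK0 hq hmain) (not_le.2 hcon)
  -- conclude
  have hL4pos : (0 : ℝ) < ((L + 1 : ℕ) : ℝ) ^ 4 := by positivity
  rw [div_le_iff₀ hL4pos]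
  exact heq.trans hgoal

end WcbcsLegendre

end Summit.HubbardSuperconductivity.HubbardSuperconductivity.Theorems
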